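import Summits.QuantumFields.BalabanUV.Beta.FP.CoarseJetOrderTwoGradedCombJunction
import Summits.QuantumFields.BalabanUV.Beta.FP.RelInvPeriodisedComb

/-!
# `BalabanUV.Beta.FP.CoarseJetOrderTwoGradedCombJunctionLive` — road «FP» (binder row D1), ROUTE T, junction J2 (structural half) of leaf-05's W-1:
# **THE DOOR's `hId₂` POLYNOMIAL IS an2's RESPONSE WORD OVER ALL TORUS SLOTS, READ AT THE COARSE MULTIPLIER SLOTS** — for ANY torus matrices `X Y`
# with KKT-shaped live blocks, `P(Θ, Θᴸ, Ŝ, Γ̂; H₁, H₂, Q₁₁, Q₁₂) = (2 • (Â·X·Â·X·Â) − Â·Y·Â)∘(fμ, fμ)`, `Â = perF M (GcombSh Lc j)`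

HONEST DEPENDENCY (page 1, mandatory): continuum YM on T⁴ ⇐ BetaPertH ∧ nine spine estimates (0/9 proved); BetaPertH ⇐ (D1) ∧ (D4) ∧ CAP+tail;
G-an2-4 gates asym, D1 and NE2/3/4.  HONEST FRAMING (cell contract, verbatim): «discharging `BetaPertH` makes Bałaban's UV stability UNCONDITIONAL —
a real constructive-QFT result; it is NOT the continuum limit and NOT the Clay problem.»  ABSOLUTE RULE (cell charter, verbatim): «No internally-minted
statement may enter as a cited fact. Every hypothesis is either kernel-proved in this package or a verbatim quotation of a PUBLISHED theorem with page
reference. The manuscript(s) under audit are NOT citable for their own disputed steps — they are the thing under adjudication; programme-internal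
(2001/route/tribunal) claims are never citable.»

WHAT ([folklore] `submatrix` ∕ `fromBlocks` bookkeeping BY NAME; no `def`, no `def … : Prop`, nothing cited, 0 sorry; every `d`, `Lc ≥ 1`, every level `j`,
every box with `Lc ∣ M_i`, any injective coarse-multiplier presentation `fμ` with `hμ`, `hcoarse` — the door's binders VERBATIM):
* §1 `perF_GcombSh_eq_zero_of_row ∕ _of_col` — `Â := perF M (GcombSh Lc j)` vanishes on every row ∕ column whose `axEc (ctr (d+1) Lc) Lc` diagonal is `0`
  (comb field slots, non-coarse multiplier slots): (T-INV)'s `Ê·Â = Â = Â·Ê` (`RelInvPeriodisedComb.perF_rules_comb`) with `Ê` diagonal (`RelInvPeriodised.perF_axEc`).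
* §2 `mask_mul_perF_GcombSh ∕ perF_GcombSh_mul_mask` — the door's `axEc` masks are IDLE on `Â`: `Θ`, `Θᴸ`, `Γ̂` (door binders `hΘ hΘL hΓc`) are plain blocks of `Â`.
* §3 the live slot map `e := Sum.elim (b ↦ (b.1, inl b.2)) fμ`: injective, and `Â`'s rows ∕ columns vanish off its range (`hcoarse`); `submatrix_sumElim_eq_fromBlocks`.
* §4 **`torus_thetaWord_eq_responseWord_comb`**: for ANY `X Y : Matrix (Idx M (Fib d)) (Idx M (Fib d)) ℝ` whose live blocks are `fromBlocks H₁ Q₁₁ᵀ Q₁₁ 0` resp.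
  `fromBlocks H₂ (−Q₁₂ᵀ) Q₁₂ 0` (eight displayed block equations), the door's polynomial (`CoarseJetOrderTwoGradedComb.torus_hId₂_iff_graded_comb`'s right side)
  `= ((2 : ℝ) • (Â * X * Â * X * Â) − Â * Y * Â).submatrix fμ fμ` (J1 §4 `submatrix_responseWord` + J1 §3 `thetaWord_eq_toBlocks₂₂`), and
  **`torus_hId₂_iff_responseWord_comb`**: the door's `hId₂` `↔ ((2 : ℝ) • (Â·X·Â·X·Â) − Â·Y·Â).submatrix fμ fμ = c • H′₂`.
* §5 GENERIC BILINEAR CONTRACTION: `sandwich₃_sum`, `sandwich₅_sum`, **`responseWord_bilinear`** — an2's per-pair words `Â·D̂_b·Â·D̂_{b′}·Â + Â·D̂_{b′}·Â·D̂_b·Â − Â·Ŵ_{bb′}·Â`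
  contracted with `v ⊗ v` give `2 • (Â·D̂_v·Â·D̂_v·Â) − Â·Ŵ_{vv}·Â` — the `X := D̂_v`, `Y := Ŵ_{vv}` of §4.
NOT HERE (J2's last step, after an2's letters 2c-iii∕iv land): `X := D̂_v`, `Y := Ŵ_{vv}` (an2's `CombHId2TorusRecord` words) — their eight block equations are
the parity letters P1 (odd first order: `SpineRecursivePureParity.trK_SpureRecAt`) ∕ P2 (even second order) and the zero `μμ` blocks; then an2's crown
`perF_dper_tsum_T2comb_succ_inl_inl` reads the right side as `(cE₂·wV4)•perF M′ (dper M′ T2_{j+1})(v,v)|ff` minus the border term.  Discharges NO binder of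
row D1; NOT the dictionary's `hId₂`, NOT (J-a), NOT (T-ID), NOT SDF, NOT D1, NEVER «G-an2-4 closed», NOT BetaPertH, NOT continuum, NOT Clay; 0 estimates.
Unit `b2b-balaban-beta-d1-formalise-leaf-05` (gen 35), 2026-08-23; no existing file touched.
-/

noncomputable section

open scoped BigOperators Matrix

namespace Summit.QuantumFields.BalabanUV.Beta.FP.CoarseJetOrderTwoGradedCombJunctionLive

open Matrix
open Literature.Probability.LatticeModels (Torus.proj)
open Literature.MathematicalPhysics.QuantumFieldTheory.Balaban1983to89
open Literature.MathematicalPhysics.QuantumFieldTheory.Balaban1983to89.Beta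
open B6Lemma24Torus (pbox)
open AffineAveraging (Site box toSite)
open AveragingContoursRooted (ctr ctrOff)
open OneStepResolventKernel (Fib)
open Summit.QuantumFields.BalabanUV.Beta.AxialDressingRooted (axEc axEc_inr_inr)
open Summit.QuantumFields.BalabanUV.Beta.CombChartStepJets (GcombSh)
open Summit.QuantumFields.BalabanUV.Beta.FP.KernelPeriodisationFib (Idx perF)
open Summit.QuantumFields.BalabanUV.Beta.FP.RelInvPeriodised (perF_axEc axEc_diag_zero_or_one)
open Summit.QuantumFields.BalabanUV.Beta.FP.RelInvPeriodisedComb (perF_rules_comb)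
open Summit.QuantumFields.BalabanUV.Beta.FP.CoarseJetOrderTwoGradedCombJunction (thetaWord_eq_toBlocks₂₂ submatrix_responseWord submatrix_sandwich₃)

variable {d : ℕ} {Lc : ℕ} [NeZero Lc] (M : Fin (d + 1) → ℕ) [∀ μ, NeZero (M μ)]

/-! ## §1 `Â` vanishes on the dead rows and columns -/

/-- [folklore] **DEAD ROWS**: if the `axEc` diagonal of the slot `P` is `0`, the `P`-row of `Â = perF M (GcombSh Lc j)` vanishes (`Ê·Â = Â`, `Ê` diagonal). -/
theorem perF_GcombSh_eq_zero_of_row (hM : ∀ i, Lc ∣ M i) (j : ℕ) (P Q : Idx M (Fib d))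
    (hP : axEc (ctr (d + 1) Lc) Lc (P.1 : Site (d + 1)) (P.1 : Site (d + 1)) P.2 P.2 = 0) :
    perF M (GcombSh (d := d) Lc j) P Q = 0 := by
  have h := congrFun (congrFun (perF_rules_comb M hM j).1 P) Q
  rw [perF_axEc M, Matrix.mul_apply, Finset.sum_eq_single P (fun R _ hR => by rw [Matrix.diagonal_apply_ne _ (Ne.symm hR), zero_mul])
    (fun h => absurd (Finset.mem_univ P) h), Matrix.diagonal_apply_eq, hP, zero_mul] at h
  exact h.symm

/-- [folklore] **DEAD COLUMNS**: if the `axEc` diagonal of the slot `Q` is `0`, the `Q`-column of `Â` vanishes (`Â·Ê = Â`). -/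
theorem perF_GcombSh_eq_zero_of_col (hM : ∀ i, Lc ∣ M i) (j : ℕ) (P Q : Idx M (Fib d))
    (hQ : axEc (ctr (d + 1) Lc) Lc (Q.1 : Site (d + 1)) (Q.1 : Site (d + 1)) Q.2 Q.2 = 0) :
    perF M (GcombSh (d := d) Lc j) P Q = 0 := by
  have h := congrFun (congrFun (perF_rules_comb M hM j).2.1 P) Q
  rw [perF_axEc M, Matrix.mul_apply, Finset.sum_eq_single Q (fun R _ hR => by rw [Matrix.diagonal_apply_ne _ hR, mul_zero])
    (fun h => absurd (Finset.mem_univ Q) h), Matrix.diagonal_apply_eq, hQ, mul_zero] at h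
  exact h.symm

/-! ## §2 The door's `axEc` masks are idle on `Â` -/

/-- [folklore] a `{0,1}`-valued row mask that kills only dead rows is idle: `axEc(P)·Â P Q = Â P Q`. -/
theorem mask_mul_perF_GcombSh (hM : ∀ i, Lc ∣ M i) (j : ℕ) (P Q : Idx M (Fib d)) :
    axEc (ctr (d + 1) Lc) Lc (P.1 : Site (d + 1)) (P.1 : Site (d + 1)) P.2 P.2 * perF M (GcombSh (d := d) Lc j) P Q
      = perF M (GcombSh (d := d) Lc j) P Q := by
  rcases axEc_diag_zero_or_one (ctr (d + 1) Lc) Lc (P.1 : Site (d + 1)) P.2 with h0 | h1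
  · rw [h0, zero_mul, perF_GcombSh_eq_zero_of_row M hM j P Q h0]
  · rw [h1, one_mul]

/-- [folklore] a column mask is idle: `axEc(Q)·Â P Q = Â P Q`. -/
theorem mask_mul_perF_GcombSh_col (hM : ∀ i, Lc ∣ M i) (j : ℕ) (P Q : Idx M (Fib d)) :
    axEc (ctr (d + 1) Lc) Lc (Q.1 : Site (d + 1)) (Q.1 : Site (d + 1)) Q.2 Q.2 * perF M (GcombSh (d := d) Lc j) P Q
      = perF M (GcombSh (d := d) Lc j) P Q := by
  rcases axEc_diag_zero_or_one (ctr (d + 1) Lc) Lc (Q.1 : Site (d + 1)) Q.2 with h0 | h1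
  · rw [h0, zero_mul, perF_GcombSh_eq_zero_of_col M hM j P Q h0]
  · rw [h1, one_mul]

/-! ## §3 The live slot map: field slots ⊕ coarse multiplier slots -/

section Slots

variable {μ : Type*} [Fintype μ] [DecidableEq μ]

omit [NeZero Lc] [∀ μ, NeZero (M μ)] [Fintype μ] [DecidableEq μ] in
/-- [folklore] the live slot map `Sum.elim (b ↦ (b.1, inl b.2)) fμ` is injective when `fμ` is injective and lands in multiplier slots. -/
theorem slotMap_injective (fμ : μ → Idx M (Fib d)) (hfμ : Function.Injective fμ) (hμ : ∀ a : μ, ∃ m : Fin (d + 1), (fμ a).2 = Sum.inr m) :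
    Function.Injective (Sum.elim (fun b : ↥(pbox M) × Fin (d + 1) => ((b.1, Sum.inl b.2) : Idx M (Fib d))) fμ) := by
  rintro (b | a) (b' | a') h
  · simp only [Sum.elim_inl] at h
    obtain ⟨h1, h2⟩ := Prod.mk.inj h
    rw [Prod.ext h1 (Sum.inl_injective h2)]
  · simp only [Sum.elim_inl, Sum.elim_inr] at h
    obtain ⟨m, hm⟩ := hμ a'
    exact absurd ((congrArg Prod.snd h).trans hm) Sum.inl_ne_inr
  · simp only [Sum.elim_inl, Sum.elim_inr] at h
    obtain ⟨m, hm⟩ := hμ a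
    exact absurd ((congrArg Prod.snd h).symm.trans hm) Sum.inl_ne_inr
  · simp only [Sum.elim_inr] at h
    rw [hfμ h]

omit [NeZero Lc] [∀ μ, NeZero (M μ)] [Fintype μ] [DecidableEq μ] in
/-- [folklore] a slot outside the range of the live slot map is a NON-COARSE multiplier slot (`hcoarse`). -/
theorem proj_ne_zero_of_not_mem_range (fμ : μ → Idx M (Fib d))
    (hcoarse : ∀ (s : ↥(pbox M)) (m : Fin (d + 1)), ((s, Sum.inr m) : Idx M (Fib d)) ∈ Set.range fμ ↔ Torus.proj Lc (s : Site (d + 1)) = 0)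
    {P : Idx M (Fib d)} (hP : P ∉ Set.range (Sum.elim (fun b : ↥(pbox M) × Fin (d + 1) => ((b.1, Sum.inl b.2) : Idx M (Fib d))) fμ)) :
    ∃ m : Fin (d + 1), P.2 = Sum.inr m ∧ Torus.proj Lc (P.1 : Site (d + 1)) ≠ 0 := by
  obtain ⟨s, a⟩ := P
  rcases a with α | m
  · exact absurd ⟨Sum.inl (s, α), rfl⟩ hP
  · refine ⟨m, rfl, fun h0 => hP ?_⟩
    obtain ⟨a, ha⟩ := (hcoarse s m).2 h0
    exact ⟨Sum.inr a, ha⟩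

omit [NeZero Lc] [∀ μ, NeZero (M μ)] [Fintype μ] [DecidableEq μ] in
/-- [folklore] a square submatrix along `Sum.elim f g` is the block matrix of the four submatrices. -/
theorem submatrix_sumElim_eq_fromBlocks {ι ν : Type*} (A : Matrix ι ι ℝ) (f : ν → ι) (g : μ → ι) :
    A.submatrix (Sum.elim f g) (Sum.elim f g) = fromBlocks (A.submatrix f f) (A.submatrix f g) (A.submatrix g f) (A.submatrix g g) := by
  ext (i | i) (j | j) <;> rfl

omit [Fintype μ] [DecidableEq μ] in
/-- [folklore] **`Â`'s ROWS VANISH OFF THE LIVE SLOTS** (comb bonds excepted: those are field slots, in range; only non-coarse multiplier slots are off range). -/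
theorem perF_GcombSh_row_support (hM : ∀ i, Lc ∣ M i) (j : ℕ) (fμ : μ → Idx M (Fib d))
    (hcoarse : ∀ (s : ↥(pbox M)) (m : Fin (d + 1)), ((s, Sum.inr m) : Idx M (Fib d)) ∈ Set.range fμ ↔ Torus.proj Lc (s : Site (d + 1)) = 0) :
    ∀ P Q : Idx M (Fib d), P ∉ Set.range (Sum.elim (fun b : ↥(pbox M) × Fin (d + 1) => ((b.1, Sum.inl b.2) : Idx M (Fib d))) fμ) →
      perF M (GcombSh (d := d) Lc j) P Q = 0 := fun P Q hP => by
  obtain ⟨m, hm, hproj⟩ := proj_ne_zero_of_not_mem_range M fμ hcoarse hP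
  refine perF_GcombSh_eq_zero_of_row M hM j P Q ?_
  rw [hm, axEc_inr_inr, if_neg fun h => hproj h.2.2]

omit [Fintype μ] [DecidableEq μ] in
/-- [folklore] **`Â`'s COLUMNS VANISH OFF THE LIVE SLOTS.** -/
theorem perF_GcombSh_col_support (hM : ∀ i, Lc ∣ M i) (j : ℕ) (fμ : μ → Idx M (Fib d))
    (hcoarse : ∀ (s : ↥(pbox M)) (m : Fin (d + 1)), ((s, Sum.inr m) : Idx M (Fib d)) ∈ Set.range fμ ↔ Torus.proj Lc (s : Site (d + 1)) = 0) :
    ∀ P Q : Idx M (Fib d), Q ∉ Set.range (Sum.elim (fun b : ↥(pbox M) × Fin (d + 1) => ((b.1, Sum.inl b.2) : Idx M (Fib d))) fμ) →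
      perF M (GcombSh (d := d) Lc j) P Q = 0 := fun P Q hQ => by
  obtain ⟨m, hm, hproj⟩ := proj_ne_zero_of_not_mem_range M fμ hcoarse hQ
  refine perF_GcombSh_eq_zero_of_col M hM j P Q ?_
  rw [hm, axEc_inr_inr, if_neg fun h => hproj h.2.2]

end Slots

/-! ## §4 The door's polynomial IS the response word over all torus slots, read at the coarse multiplier slots -/

section Main

variable {μ : Type*} [Fintype μ]

set_option synthInstance.maxSize 1024 in
/-- **[folklore] `torus_thetaWord_eq_responseWord_comb` — THE DOOR's `hId₂` POLYNOMIAL AS an2's RESPONSE WORD.**  At the chart-(III′) literal (`Â := perF M (GcombSh Lc j)`,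
the door's `Θ Θᴸ Ŝ Γ̂` binders VERBATIM), for ANY torus matrices `X Y` whose blocks on (field slots, `fμ`-slots) are `(H₁, Q₁₁ᵀ; Q₁₁, 0)` resp. `(H₂, −Q₁₂ᵀ; Q₁₂, 0)`:
`P(Θ, Θᴸ, Ŝ, Γ̂; H₁, H₂, Q₁₁, Q₁₂) = ((2 : ℝ) • (Â·X·Â·X·Â) − Â·Y·Â)∘(fμ, fμ)`. -/
theorem torus_thetaWord_eq_responseWord_comb (hM : ∀ i, Lc ∣ M i) (j : ℕ)
    (fμ : μ → Idx M (Fib d)) (hfμ : Function.Injective fμ) (hμ : ∀ a : μ, ∃ m : Fin (d + 1), (fμ a).2 = Sum.inr m)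
    (hcoarse : ∀ (s : ↥(pbox M)) (m : Fin (d + 1)), ((s, Sum.inr m) : Idx M (Fib d)) ∈ Set.range fμ ↔ Torus.proj Lc (s : Site (d + 1)) = 0)
    {Θ : Matrix (↥(pbox M) × Fin (d + 1)) μ ℝ} {ΘL : Matrix μ (↥(pbox M) × Fin (d + 1)) ℝ} {Ŝ : Matrix μ μ ℝ}
    {Γc : Matrix (↥(pbox M) × Fin (d + 1)) (↥(pbox M) × Fin (d + 1)) ℝ}
    (hΘ : Θ = Matrix.of fun (b : ↥(pbox M) × Fin (d + 1)) (a : μ) =>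
        axEc (ctr (d + 1) Lc) Lc (b.1 : Site (d + 1)) (b.1 : Site (d + 1)) (Sum.inl b.2) (Sum.inl b.2)
          * perF M (GcombSh (d := d) Lc j) (b.1, Sum.inl b.2) (fμ a))
    (hΘL : ΘL = Matrix.of fun (a : μ) (b : ↥(pbox M) × Fin (d + 1)) =>
        axEc (ctr (d + 1) Lc) Lc (b.1 : Site (d + 1)) (b.1 : Site (d + 1)) (Sum.inl b.2) (Sum.inl b.2)
          * perF M (GcombSh (d := d) Lc j) (fμ a) (b.1, Sum.inl b.2))
    (hŜ : Ŝ = (perF M (GcombSh (d := d) Lc j)).submatrix fμ fμ)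
    (hΓc : Γc = Matrix.of fun (b b' : ↥(pbox M) × Fin (d + 1)) =>
        axEc (ctr (d + 1) Lc) Lc (b.1 : Site (d + 1)) (b.1 : Site (d + 1)) (Sum.inl b.2) (Sum.inl b.2)
          * (axEc (ctr (d + 1) Lc) Lc (b'.1 : Site (d + 1)) (b'.1 : Site (d + 1)) (Sum.inl b'.2) (Sum.inl b'.2)
            * perF M (GcombSh (d := d) Lc j) (b.1, Sum.inl b.2) (b'.1, Sum.inl b'.2)))
    (X Y : Matrix (Idx M (Fib d)) (Idx M (Fib d)) ℝ)
    (H₁ H₂ : Matrix (↥(pbox M) × Fin (d + 1)) (↥(pbox M) × Fin (d + 1)) ℝ) (Q₁₁ Q₁₂ : Matrix μ (↥(pbox M) × Fin (d + 1)) ℝ)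
    (hXff : X.submatrix (fun b : ↥(pbox M) × Fin (d + 1) => ((b.1, Sum.inl b.2) : Idx M (Fib d))) (fun b : ↥(pbox M) × Fin (d + 1) => ((b.1, Sum.inl b.2) : Idx M (Fib d))) = H₁)
    (hXfm : X.submatrix (fun b : ↥(pbox M) × Fin (d + 1) => ((b.1, Sum.inl b.2) : Idx M (Fib d))) fμ = Q₁₁ᵀ)
    (hXmf : X.submatrix fμ (fun b : ↥(pbox M) × Fin (d + 1) => ((b.1, Sum.inl b.2) : Idx M (Fib d))) = Q₁₁)
    (hXmm : X.submatrix fμ fμ = 0)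
    (hYff : Y.submatrix (fun b : ↥(pbox M) × Fin (d + 1) => ((b.1, Sum.inl b.2) : Idx M (Fib d))) (fun b : ↥(pbox M) × Fin (d + 1) => ((b.1, Sum.inl b.2) : Idx M (Fib d))) = H₂)
    (hYfm : Y.submatrix (fun b : ↥(pbox M) × Fin (d + 1) => ((b.1, Sum.inl b.2) : Idx M (Fib d))) fμ = -Q₁₂ᵀ)
    (hYmf : Y.submatrix fμ (fun b : ↥(pbox M) × Fin (d + 1) => ((b.1, Sum.inl b.2) : Idx M (Fib d))) = Q₁₂)
    (hYmm : Y.submatrix fμ fμ = 0) :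
    ((-((-ΘL * H₁ - Ŝ * Q₁₁) * Γc - -ΘL * Q₁₁ᵀ * -ΘL) * H₁ + -ΘL * H₂
          - (((-ΘL * H₁ - Ŝ * Q₁₁) * Θ + -ΘL * Q₁₁ᵀ * Ŝ) * Q₁₁ + Ŝ * Q₁₂)) * Θ
        + (-ΘL * H₁ - Ŝ * Q₁₁) * (-((Γc * H₁ + Θ * Q₁₁) * Θ + Γc * Q₁₁ᵀ * Ŝ)))
      - ((-((-ΘL * H₁ - Ŝ * Q₁₁) * Γc - -ΘL * Q₁₁ᵀ * -ΘL) * (-Q₁₁ᵀ) + -ΘL * Q₁₂ᵀ) * Ŝ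
          + -ΘL * (-Q₁₁ᵀ) * ((-ΘL * H₁ - Ŝ * Q₁₁) * Θ + -ΘL * Q₁₁ᵀ * Ŝ))
      = (((2 : ℝ) • (perF M (GcombSh (d := d) Lc j) * X * perF M (GcombSh (d := d) Lc j) * X * perF M (GcombSh (d := d) Lc j))
          - perF M (GcombSh (d := d) Lc j) * Y * perF M (GcombSh (d := d) Lc j))).submatrix fμ fμ := by
  set A := perF M (GcombSh (d := d) Lc j) with hA
  set fs : ↥(pbox M) × Fin (d + 1) → Idx M (Fib d) := fun b => ((b.1, Sum.inl b.2) : Idx M (Fib d)) with hfs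
  set e := Sum.elim fs fμ with he
  have hinj : Function.Injective e := slotMap_injective M fμ hfμ hμ
  have hr := perF_GcombSh_row_support M hM j fμ hcoarse
  have hc := perF_GcombSh_col_support M hM j fμ hcoarse
  -- the masks are idle: the door's four blocks are `Â`'s live blocks
  have hΘ' : Θ = A.submatrix fs fμ := by
    rw [hΘ]; ext b a; exact mask_mul_perF_GcombSh M hM j (fs b) (fμ a)
  have hΘL' : ΘL = A.submatrix fμ fs := by
    rw [hΘL]; ext a b; exact mask_mul_perF_GcombSh_col M hM j (fμ a) (fs b)
  have hΓc' : Γc = A.submatrix fs fs := by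
    rw [hΓc]; ext b b'
    rw [Matrix.of_apply, Matrix.submatrix_apply, mask_mul_perF_GcombSh_col M hM j (fs b) (fs b'), mask_mul_perF_GcombSh M hM j (fs b) (fs b')]
  -- the `fμ fμ` block is the `₂₂` block of the `e e` submatrix
  have h22 : ∀ Z : Matrix (Idx M (Fib d)) (Idx M (Fib d)) ℝ, Z.submatrix fμ fμ = (Z.submatrix e e).toBlocks₂₂ := fun Z => by
    ext a a'; rfl
  rw [h22, submatrix_responseWord hinj A X Y hr hc, submatrix_sumElim_eq_fromBlocks, submatrix_sumElim_eq_fromBlocks, submatrix_sumElim_eq_fromBlocks,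
    ← hΘ', ← hΘL', ← hΓc', ← hŜ, hXff, hXfm, hXmf, hXmm, hYff, hYfm, hYmf, hYmm]
  exact thetaWord_eq_toBlocks₂₂ Γc H₁ H₂ Θ ΘL Ŝ Q₁₁ Q₁₂

set_option synthInstance.maxSize 1024 in
/-- **[folklore] `torus_hId₂_iff_responseWord_comb`** — hence the door's `hId₂` at the chart-(III′) tables (`CoarseJetOrderTwoGradedComb.torus_hId₂_iff_graded_comb`'s
right side) reads, for any scalar `c` and candidate `H′₂`: `P(…) = c • H′₂ ↔ ((2 : ℝ) • (Â·X·Â·X·Â) − Â·Y·Â)∘(fμ, fμ) = c • H′₂`. -/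
theorem torus_hId₂_iff_responseWord_comb (hM : ∀ i, Lc ∣ M i) (j : ℕ)
    (fμ : μ → Idx M (Fib d)) (hfμ : Function.Injective fμ) (hμ : ∀ a : μ, ∃ m : Fin (d + 1), (fμ a).2 = Sum.inr m)
    (hcoarse : ∀ (s : ↥(pbox M)) (m : Fin (d + 1)), ((s, Sum.inr m) : Idx M (Fib d)) ∈ Set.range fμ ↔ Torus.proj Lc (s : Site (d + 1)) = 0)
    {Θ : Matrix (↥(pbox M) × Fin (d + 1)) μ ℝ} {ΘL : Matrix μ (↥(pbox M) × Fin (d + 1)) ℝ} {Ŝ : Matrix μ μ ℝ}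
    {Γc : Matrix (↥(pbox M) × Fin (d + 1)) (↥(pbox M) × Fin (d + 1)) ℝ}
    (hΘ : Θ = Matrix.of fun (b : ↥(pbox M) × Fin (d + 1)) (a : μ) =>
        axEc (ctr (d + 1) Lc) Lc (b.1 : Site (d + 1)) (b.1 : Site (d + 1)) (Sum.inl b.2) (Sum.inl b.2)
          * perF M (GcombSh (d := d) Lc j) (b.1, Sum.inl b.2) (fμ a))
    (hΘL : ΘL = Matrix.of fun (a : μ) (b : ↥(pbox M) × Fin (d + 1)) =>
        axEc (ctr (d + 1) Lc) Lc (b.1 : Site (d + 1)) (b.1 : Site (d + 1)) (Sum.inl b.2) (Sum.inl b.2)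
          * perF M (GcombSh (d := d) Lc j) (fμ a) (b.1, Sum.inl b.2))
    (hŜ : Ŝ = (perF M (GcombSh (d := d) Lc j)).submatrix fμ fμ)
    (hΓc : Γc = Matrix.of fun (b b' : ↥(pbox M) × Fin (d + 1)) =>
        axEc (ctr (d + 1) Lc) Lc (b.1 : Site (d + 1)) (b.1 : Site (d + 1)) (Sum.inl b.2) (Sum.inl b.2)
          * (axEc (ctr (d + 1) Lc) Lc (b'.1 : Site (d + 1)) (b'.1 : Site (d + 1)) (Sum.inl b'.2) (Sum.inl b'.2)
            * perF M (GcombSh (d := d) Lc j) (b.1, Sum.inl b.2) (b'.1, Sum.inl b'.2)))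
    (X Y : Matrix (Idx M (Fib d)) (Idx M (Fib d)) ℝ)
    (H₁ H₂ : Matrix (↥(pbox M) × Fin (d + 1)) (↥(pbox M) × Fin (d + 1)) ℝ) (Q₁₁ Q₁₂ : Matrix μ (↥(pbox M) × Fin (d + 1)) ℝ)
    (hXff : X.submatrix (fun b : ↥(pbox M) × Fin (d + 1) => ((b.1, Sum.inl b.2) : Idx M (Fib d))) (fun b : ↥(pbox M) × Fin (d + 1) => ((b.1, Sum.inl b.2) : Idx M (Fib d))) = H₁)
    (hXfm : X.submatrix (fun b : ↥(pbox M) × Fin (d + 1) => ((b.1, Sum.inl b.2) : Idx M (Fib d))) fμ = Q₁₁ᵀ)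
    (hXmf : X.submatrix fμ (fun b : ↥(pbox M) × Fin (d + 1) => ((b.1, Sum.inl b.2) : Idx M (Fib d))) = Q₁₁)
    (hXmm : X.submatrix fμ fμ = 0)
    (hYff : Y.submatrix (fun b : ↥(pbox M) × Fin (d + 1) => ((b.1, Sum.inl b.2) : Idx M (Fib d))) (fun b : ↥(pbox M) × Fin (d + 1) => ((b.1, Sum.inl b.2) : Idx M (Fib d))) = H₂)
    (hYfm : Y.submatrix (fun b : ↥(pbox M) × Fin (d + 1) => ((b.1, Sum.inl b.2) : Idx M (Fib d))) fμ = -Q₁₂ᵀ)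
    (hYmf : Y.submatrix fμ (fun b : ↥(pbox M) × Fin (d + 1) => ((b.1, Sum.inl b.2) : Idx M (Fib d))) = Q₁₂)
    (hYmm : Y.submatrix fμ fμ = 0) (c : ℝ) (H'₂ : Matrix μ μ ℝ) :
    ((-((-ΘL * H₁ - Ŝ * Q₁₁) * Γc - -ΘL * Q₁₁ᵀ * -ΘL) * H₁ + -ΘL * H₂
          - (((-ΘL * H₁ - Ŝ * Q₁₁) * Θ + -ΘL * Q₁₁ᵀ * Ŝ) * Q₁₁ + Ŝ * Q₁₂)) * Θ
        + (-ΘL * H₁ - Ŝ * Q₁₁) * (-((Γc * H₁ + Θ * Q₁₁) * Θ + Γc * Q₁₁ᵀ * Ŝ)))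
      - ((-((-ΘL * H₁ - Ŝ * Q₁₁) * Γc - -ΘL * Q₁₁ᵀ * -ΘL) * (-Q₁₁ᵀ) + -ΘL * Q₁₂ᵀ) * Ŝ
          + -ΘL * (-Q₁₁ᵀ) * ((-ΘL * H₁ - Ŝ * Q₁₁) * Θ + -ΘL * Q₁₁ᵀ * Ŝ)) = c • H'₂
      ↔ (((2 : ℝ) • (perF M (GcombSh (d := d) Lc j) * X * perF M (GcombSh (d := d) Lc j) * X * perF M (GcombSh (d := d) Lc j))
          - perF M (GcombSh (d := d) Lc j) * Y * perF M (GcombSh (d := d) Lc j))).submatrix fμ fμ = c • H'₂ := by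
  rw [torus_thetaWord_eq_responseWord_comb M hM j fμ hfμ hμ hcoarse hΘ hΘL hŜ hΓc X Y H₁ H₂ Q₁₁ Q₁₂ hXff hXfm hXmf hXmm hYff hYfm hYmf hYmm]

set_option synthInstance.maxSize 1024 in
/-- **[folklore] `torus_sandwich_symmJet_comb` — A SYMMETRIC-TWIN KKT-SHAPED JET SANDWICHED BY `Â`, READ AT THE COARSE SLOTS**: for ANY torus matrix `Z`
whose live blocks are `(Hᶻ, Qᶻᵀ; Qᶻ, 0)` (the placement of a FIRST-order — parity-odd — word, e.g. an2's response word along the second-response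
direction), `(Â·Z·Â)∘(fμ,fμ) = Θᴸ·Hᶻ·Θ + Θᴸ·Qᶻᵀ·Ŝ + Ŝ·Qᶻ·Θ`. -/
theorem torus_sandwich_symmJet_comb (hM : ∀ i, Lc ∣ M i) (j : ℕ)
    (fμ : μ → Idx M (Fib d)) (hfμ : Function.Injective fμ) (hμ : ∀ a : μ, ∃ m : Fin (d + 1), (fμ a).2 = Sum.inr m)
    (hcoarse : ∀ (s : ↥(pbox M)) (m : Fin (d + 1)), ((s, Sum.inr m) : Idx M (Fib d)) ∈ Set.range fμ ↔ Torus.proj Lc (s : Site (d + 1)) = 0)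
    {Θ : Matrix (↥(pbox M) × Fin (d + 1)) μ ℝ} {ΘL : Matrix μ (↥(pbox M) × Fin (d + 1)) ℝ} {Ŝ : Matrix μ μ ℝ}
    (hΘ : Θ = Matrix.of fun (b : ↥(pbox M) × Fin (d + 1)) (a : μ) =>
        axEc (ctr (d + 1) Lc) Lc (b.1 : Site (d + 1)) (b.1 : Site (d + 1)) (Sum.inl b.2) (Sum.inl b.2)
          * perF M (GcombSh (d := d) Lc j) (b.1, Sum.inl b.2) (fμ a))
    (hΘL : ΘL = Matrix.of fun (a : μ) (b : ↥(pbox M) × Fin (d + 1)) =>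
        axEc (ctr (d + 1) Lc) Lc (b.1 : Site (d + 1)) (b.1 : Site (d + 1)) (Sum.inl b.2) (Sum.inl b.2)
          * perF M (GcombSh (d := d) Lc j) (fμ a) (b.1, Sum.inl b.2))
    (hŜ : Ŝ = (perF M (GcombSh (d := d) Lc j)).submatrix fμ fμ)
    (Z : Matrix (Idx M (Fib d)) (Idx M (Fib d)) ℝ)
    (Hz : Matrix (↥(pbox M) × Fin (d + 1)) (↥(pbox M) × Fin (d + 1)) ℝ) (Qz : Matrix μ (↥(pbox M) × Fin (d + 1)) ℝ)
    (hZff : Z.submatrix (fun b : ↥(pbox M) × Fin (d + 1) => ((b.1, Sum.inl b.2) : Idx M (Fib d))) (fun b : ↥(pbox M) × Fin (d + 1) => ((b.1, Sum.inl b.2) : Idx M (Fib d))) = Hz)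
    (hZfm : Z.submatrix (fun b : ↥(pbox M) × Fin (d + 1) => ((b.1, Sum.inl b.2) : Idx M (Fib d))) fμ = Qzᵀ)
    (hZmf : Z.submatrix fμ (fun b : ↥(pbox M) × Fin (d + 1) => ((b.1, Sum.inl b.2) : Idx M (Fib d))) = Qz)
    (hZmm : Z.submatrix fμ fμ = 0) :
    (perF M (GcombSh (d := d) Lc j) * Z * perF M (GcombSh (d := d) Lc j)).submatrix fμ fμ = ΘL * Hz * Θ + ΘL * Qzᵀ * Ŝ + Ŝ * Qz * Θ := by
  set A := perF M (GcombSh (d := d) Lc j) with hA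
  set fs : ↥(pbox M) × Fin (d + 1) → Idx M (Fib d) := fun b => ((b.1, Sum.inl b.2) : Idx M (Fib d)) with hfs
  set e := Sum.elim fs fμ with he
  have hinj : Function.Injective e := slotMap_injective M fμ hfμ hμ
  have hr := perF_GcombSh_row_support M hM j fμ hcoarse
  have hc := perF_GcombSh_col_support M hM j fμ hcoarse
  have hΘ' : Θ = A.submatrix fs fμ := by
    rw [hΘ]; ext b a; exact mask_mul_perF_GcombSh M hM j (fs b) (fμ a)
  have hΘL' : ΘL = A.submatrix fμ fs := by
    rw [hΘL]; ext a b; exact mask_mul_perF_GcombSh_col M hM j (fμ a) (fs b)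
  have h22 : ∀ W : Matrix (Idx M (Fib d)) (Idx M (Fib d)) ℝ, W.submatrix fμ fμ = (W.submatrix e e).toBlocks₂₂ := fun W => by
    ext a a'; rfl
  rw [h22, submatrix_sandwich₃ hinj A Z hr hc, submatrix_sumElim_eq_fromBlocks, submatrix_sumElim_eq_fromBlocks, ← hΘ', ← hΘL', ← hŜ, hZff, hZfm, hZmf,
    hZmm, fromBlocks_multiply, fromBlocks_multiply, toBlocks_fromBlocks₂₂]
  simp only [Matrix.mul_zero, add_zero, Matrix.add_mul, Matrix.mul_assoc]
  abel

end Main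

/-! ## §5 Generic: the bilinear contraction of an2's per-pair response words along a coarse direction `v` -/

section Bilinear

variable {ι β : Type*} [Fintype ι] [Fintype β]

/-- [folklore] `Σ_{b b′} c_{bb′} • (A·W_{bb′}·A) = A·(Σ c • W)·A`. -/
theorem sandwich₃_sum (A : Matrix ι ι ℝ) (W : β → β → Matrix ι ι ℝ) (c : β → β → ℝ) :
    ∑ b, ∑ b', c b b' • (A * W b b' * A) = A * (∑ b, ∑ b', c b b' • W b b') * A := by
  simp only [Matrix.mul_sum, Matrix.sum_mul, Matrix.mul_smul, Matrix.smul_mul]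

/-- [folklore] `Σ_{b b′} (v_b v_{b′}) • (A·D_b·A·D_{b′}·A) = A·D_v·A·D_v·A` with `D_v := Σ_b v_b • D_b`. -/
theorem sandwich₅_sum (A : Matrix ι ι ℝ) (D : β → Matrix ι ι ℝ) (v : β → ℝ) :
    ∑ b, ∑ b', (v b * v b') • (A * D b * A * D b' * A) = A * (∑ b, v b • D b) * A * (∑ b, v b • D b) * A := by
  simp only [Matrix.mul_sum, Matrix.sum_mul, Matrix.mul_smul, Matrix.smul_mul, Finset.smul_sum, smul_smul]
  rw [Finset.sum_comm]
  exact Finset.sum_congr rfl fun b _ => Finset.sum_congr rfl fun b' _ => by rw [mul_comm (v b') (v b)]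

/-- **[folklore] `responseWord_bilinear`** — an2's per-pair words contracted with `v ⊗ v`:
`Σ_{b b′} (v_b v_{b′}) • (A·D_b·A·D_{b′}·A + A·D_{b′}·A·D_b·A − A·W_{bb′}·A) = 2 • (A·D_v·A·D_v·A) − A·W_{vv}·A`,
`D_v := Σ_b v_b • D_b`, `W_{vv} := Σ_{b b′} (v_b v_{b′}) • W_{bb′}` — the `X`, `Y` of §4. -/
theorem responseWord_bilinear (A : Matrix ι ι ℝ) (D : β → Matrix ι ι ℝ) (W : β → β → Matrix ι ι ℝ) (v : β → ℝ) :
    ∑ b, ∑ b', (v b * v b') • (A * D b * A * D b' * A + A * D b' * A * D b * A - A * W b b' * A)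
      = (2 : ℝ) • (A * (∑ b, v b • D b) * A * (∑ b, v b • D b) * A) - A * (∑ b, ∑ b', (v b * v b') • W b b') * A := by
  have h1 : ∑ b, ∑ b', (v b * v b') • (A * D b' * A * D b * A) = ∑ b, ∑ b', (v b * v b') • (A * D b * A * D b' * A) := by
    rw [Finset.sum_comm]
    exact Finset.sum_congr rfl fun b _ => Finset.sum_congr rfl fun b' _ => by rw [mul_comm (v b') (v b)]
  simp only [smul_add, smul_sub, Finset.sum_add_distrib, Finset.sum_sub_distrib, h1, sandwich₅_sum, sandwich₃_sum, two_smul]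

end Bilinear

end Summit.QuantumFields.BalabanUV.Beta.FP.CoarseJetOrderTwoGradedCombJunctionLive

end
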